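import Literature.NumberTheory.EllipticCurves.Agboola2007.RestrictedSelmerGroups
import HarnessLib

/-!
# Stub `stub_heegnerIndexLowerAtTwo` (stmt-BirchSwinnertonDyer-27851, route `PrintCf2`), STUB-PLAN v1.4 §4 T2⁻/V1⁻:
# the BOTTOM VALUE of the LOWER chain split into two independent sockets — kernel-checked bookkeeping + the two mechanisms

Stub-critic `scrit-stub_heegnerIndexLowerAtTwo` g3 (planner; cell `bsd-print-cf2`). A CERTIFICATE, not a proposal: any idle width
seat may land it `--supports stmt-BirchSwinnertonDyer-27851`. HONEST FRAMING: theorems only (no definition, no named fact, no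
`sorry`); nothing here closes a crux or a stub; BSD is not proved by any of this.

## What V1⁻ is (STUB-PLAN v1.3 §4, T2⁻) and why it splits

The LOWER child consumes, below the kernel-checked one-sided control `valuation_constantCoeff_le_of_finite_bottom`
(`StubPlanT2LowerOneSidedControl.lean`), exactly ONE arithmetic value at the bottom of the `𝔭*`-adic tower:

  V1⁻ : `Finite 𝔖_{𝔮}(K₀, M)` and `v_p #𝔖_{𝔮}(K₀, M) ≤ (Ш-term) + (local index terms)`,

for `M = W* = E[𝔭*^∞]` (the CM summand `endEigenPrimaryTorsion 2 π r`), `𝔮 = 𝔭* = v̄` (STRICT), the other place `𝔮' = 𝔭 = v`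
above `2` RELAXED, every `w ∤ 2` locally trivial (`Agboola2007.restrictedSelmerBase M p 𝔮 = selmerOver ⊤ M p 𝔮 ∅`).
Write `S₀ := 𝔖_𝔮 ⊓ 𝔖_{𝔮'}` (strict at BOTH places above `p`, trivial elsewhere). Then `#𝔖_𝔮 = #S₀ · [𝔖_𝔮 : S₀]`
(`card_eq_card_inf_mul_relIndex`) and the two factors are controlled by DIFFERENT, INDEPENDENT mechanisms:

* V1⁻a (`card_dvd_card_inf_mul_relIndex`; pure algebra, NO duality): for any `T ≥ S₀` and any `N ≤` the ambient group,
  `#S₀ ∣ #(S₀ ⊓ N) · [T : N ⊓ T]`-shape — intended `T` = the classical `𝔭*^∞`-Selmer group of `E/K₀` cut out inside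
  `H¹(K₀, W*)` (strict at `𝔭`, Kummer at `𝔭*`, trivial at `w ∤ 2`; it contains `S₀`), `N` = the Kummer image of
  `E(K₀) ⊗ K_{𝔭*}/𝓞_{𝔭*}`; `T/N ↠ Ш(E/K₀)[𝔭*^∞]` and `S₀ ⊓ N = ker(E(K₀) ⊗ K_{𝔭*}/𝓞_{𝔭*} → E(K₀,𝔭*) ⊗ ℚ₂/ℤ₂)` is finite of
  order `2^{ℓ_{𝔭*}}` (the local index of the generator at `𝔭*`; NO non-vanishing input: a non-torsion global point is non-torsion
  locally).  Gives `v₂ #S₀ ≤ ord₂ #Ш(E/K₀)[𝔭*^∞] + ℓ_{𝔭*}` from `Finite Ш` and `rank_𝓞 E(K₀) = 1` only.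
* V1⁻b (`relIndex_dvd_card_of_loc`; ONE-PLACE duality, only the CHEAP half of Poitou–Tate): `𝔖_𝔮/S₀ ↪ H¹(K₀,𝔭, W*)` by `loc_𝔭`,
  and the image is ANNIHILATED (local Tate pairing at `𝔭`) by `loc_𝔭` of every global class of the Tate-dual module that is
  unramified/relaxed where `𝔖_𝔮` is strict — in particular by `loc_𝔭 κ(E(K₀) ⊗ 𝓞_𝔭)`; this is `Im ⊆ Ann`, i.e. the sum formula
  `∑_v ⟨x_v, y_v⟩_v = 0` (`LocalInvariants.SumLocalTermEqZero`, PROVED for every totally complex `K` — so for `K₀ = ℚ(√−7)` — by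
  `GaloisCohomology.poitouTate_sum_localTatePairing_eq_zero_of_isTotallyComplex`, finite level `2^k`), and `#Ann(U) = [H¹(K₀,𝔭, T_𝔭E) : U]`
  by local Tate duality at the single place `𝔭` (`LocalInvariants.IsPerfect`, same theorem).  Gives
  `v₂ [𝔖_𝔮 : S₀] ≤ ℓ_𝔭 + t_𝔭` (`ℓ_𝔭` = local index of the generator at `𝔭`, `t_𝔭 = ord₂ #E(K₀,𝔭)[𝔭^∞]`), NOT the `≥`.
  The DEEP half of Poitou–Tate (`Ker ⊆ Im`, `SelmerComplement`, named fact `poitouTate_selmerStructure_duality`) and Agboola's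
  EQUALITY (Compositio 143 (2007) §6 / Prop. 8.1) are NOT needed by the LOWER child.

By complex conjugation `ℓ_𝔭 = ℓ_{𝔭*} = ℓ` (the `ℓ` of S2′ `stub_rubinValueFormula_two`), so V1⁻ reads
`v₂ #𝔖_{v̄}(K₀, W*) ≤ ord₂ #Ш(W_{K₀})[v̄^∞] + 2ℓ + t_v` — the shape recorded in STUB-PLAN v1.3 §4 (V1), now with BOTH summands
sourced.  This file proves only the group-theoretic skeleton of the split (generic `AddCommGroup`), then specialises the
composition to `restrictedSelmerBase` so that the two sockets have FIXED carriers a width seat can discharge independently.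

References: A. Agboola, Compositio Math. 143 (2007) §3 Prop. 3.2, §6, Prop. 8.1 [Agboola2007]; J. S. Milne, *Arithmetic Duality
Theorems* I Cor. 2.3, Thm. 4.10(b) [MilneADT2006]; B. Howard, Compositio 140 (2004) Thm. 2.1.11; R. Greenberg, LNM 1716 §3.
-/

set_option autoImplicit false
-- D-0017: single-problem summit, so the namespace repeats the summit name by design.
set_option linter.dupNamespace false

noncomputable section

open scoped Classical

namespace Summit.BirchSwinnertonDyer.BirchSwinnertonDyer.Theorems.PrintCf2.LowerStubBottom

universe u

/-! ## §1 Generic bookkeeping in an additive commutative group -/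

section Generic

variable {G : Type*} [AddCommGroup G]

/-- `#A = #(A ⊓ B) · [A : A ⊓ B]` (with the conventions `Nat.card = 0` for infinite types and `relIndex = 0` for infinite
index, the identity holds unconditionally). [folklore] -/
theorem card_eq_card_inf_mul_relIndex (A B : AddSubgroup G) :
    Nat.card A = Nat.card ↥(A ⊓ B) * (A ⊓ B).relIndex A := by
  rw [AddSubgroup.relIndex, ← AddSubgroup.card_mul_index ((A ⊓ B).addSubgroupOf A)]
  congr 1
  exact Nat.card_congr (AddSubgroup.addSubgroupOfEquivOfLe (inf_le_left : A ⊓ B ≤ A)).toEquiv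

/-- **The V1⁻ composition, generic form.** If `A ⊓ B` is finite with `v_p #(A ⊓ B) ≤ a` (socket V1⁻a) and `A ⊓ B` has
finite index in `A` with `v_p [A : A ⊓ B] ≤ b` (socket V1⁻b), then `A` is finite and `v_p #A ≤ a + b`. [folklore] -/
theorem finite_and_padicValNat_card_le_of_split {p : ℕ} [Fact p.Prime] (A B : AddSubgroup G) {a b : ℕ}
    (hfin : Finite ↥(A ⊓ B)) (ha : padicValNat p (Nat.card ↥(A ⊓ B)) ≤ a)
    (hidx : (A ⊓ B).relIndex A ≠ 0) (hb : padicValNat p ((A ⊓ B).relIndex A) ≤ b) :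
    Finite A ∧ padicValNat p (Nat.card A) ≤ a + b := by
  have hcard := card_eq_card_inf_mul_relIndex A B
  have h0 : Nat.card ↥(A ⊓ B) ≠ 0 := (Nat.card_pos (α := ↥(A ⊓ B))).ne'
  have hA0 : Nat.card A ≠ 0 := by
    rw [hcard]
    exact mul_ne_zero h0 hidx
  refine ⟨Nat.finite_of_card_ne_zero hA0, ?_⟩
  rw [hcard, padicValNat.mul h0 hidx]
  omega

/-- **Mechanism of socket V1⁻b (one-place duality).** If an additive map `loc` on `A` (intended: localisation at the RELAXED
place `𝔭`) has kernel exactly `A ⊓ B` (intended: `B` imposes strictness at `𝔭`) and its image lies in a subgroup `Ann`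
(intended: the annihilator, under the local Tate pairing at `𝔭`, of the localisations of the global dual classes — `Im ⊆ Ann`,
the CHEAP half of Poitou–Tate), then `[A : A ⊓ B] ∣ #Ann`. [folklore] -/
theorem relIndex_dvd_card_of_loc {L : Type*} [AddCommGroup L] (A B : AddSubgroup G) (loc : ↥A →+ L)
    (hker : loc.ker = (A ⊓ B).addSubgroupOf A) (Ann : AddSubgroup L) (hrange : loc.range ≤ Ann) :
    (A ⊓ B).relIndex A ∣ Nat.card Ann := by
  rw [AddSubgroup.relIndex, ← hker, AddSubgroup.index_ker]
  exact AddSubgroup.card_dvd_of_le hrange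

/-- Socket V1⁻b in valuation form: with `Ann` finite, `[A : A ⊓ B] ≠ 0` and `v_p [A : A ⊓ B] ≤ v_p #Ann`. [folklore] -/
theorem relIndex_ne_zero_and_padicValNat_le_of_loc {p : ℕ} [Fact p.Prime] {L : Type*} [AddCommGroup L]
    (A B : AddSubgroup G) (loc : ↥A →+ L) (hker : loc.ker = (A ⊓ B).addSubgroupOf A) (Ann : AddSubgroup L)
    (hrange : loc.range ≤ Ann) (hAnn : Finite Ann) :
    (A ⊓ B).relIndex A ≠ 0 ∧ padicValNat p ((A ⊓ B).relIndex A) ≤ padicValNat p (Nat.card Ann) := by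
  have hdvd := relIndex_dvd_card_of_loc A B loc hker Ann hrange
  have hAnn0 : Nat.card Ann ≠ 0 := (Nat.card_pos (α := ↥Ann)).ne'
  obtain ⟨c, hc⟩ := hdvd
  have hidx : (A ⊓ B).relIndex A ≠ 0 := fun h ↦ hAnn0 (by rw [hc, h, zero_mul])
  have hc0 : c ≠ 0 := fun h ↦ hAnn0 (by rw [hc, h, mul_zero])
  refine ⟨hidx, ?_⟩
  rw [hc, padicValNat.mul hidx hc0]
  omega

/-- **Mechanism of socket V1⁻a (no duality).** For `S ≤ T` and any `N`: `#S ∣ #(S ⊓ N) · [T : N ⊓ T]` — `S/(S ⊓ N)` embeds in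
`T/(N ⊓ T)` (intended: `S = S₀`, `T` = the classical Selmer group containing it, `N` = the Kummer image of the Mordell–Weil
group, `T/(N ⊓ T) = Ш`-part, `S ⊓ N` = the kernel of the global-to-local Kummer map at the strict place). [folklore] -/
theorem card_dvd_card_inf_mul_relIndex (S N T : AddSubgroup G) (hST : S ≤ T) :
    Nat.card S ∣ Nat.card ↥(S ⊓ N) * N.relIndex T := by
  rw [card_eq_card_inf_mul_relIndex S N, AddSubgroup.inf_relIndex_left]
  refine mul_dvd_mul_left _ ?_
  haveI : (N.addSubgroupOf T).Normal := ⟨fun n hn g ↦ by simpa [add_comm, add_assoc] using hn⟩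
  have h := AddSubgroup.relIndex_dvd_index_of_normal (H := N.addSubgroupOf T) (K := S.addSubgroupOf T)
  rwa [AddSubgroup.relIndex_addSubgroupOf hST] at h

/-- Socket V1⁻a in valuation form: `S ⊓ N` finite, `[T : N ⊓ T] ≠ 0` ⟹ `S` finite and
`v_p #S ≤ v_p #(S ⊓ N) + v_p [T : N ⊓ T]`. [folklore] -/
theorem finite_and_padicValNat_card_le_of_kummer {p : ℕ} [Fact p.Prime] (S N T : AddSubgroup G) (hST : S ≤ T)
    (hfin : Finite ↥(S ⊓ N)) (hidx : N.relIndex T ≠ 0) :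
    Finite S ∧ padicValNat p (Nat.card S) ≤ padicValNat p (Nat.card ↥(S ⊓ N)) + padicValNat p (N.relIndex T) := by
  have hdvd := card_dvd_card_inf_mul_relIndex S N T hST
  have h0 : Nat.card ↥(S ⊓ N) ≠ 0 := (Nat.card_pos (α := ↥(S ⊓ N))).ne'
  have hprod : Nat.card ↥(S ⊓ N) * N.relIndex T ≠ 0 := mul_ne_zero h0 hidx
  have hS0 : Nat.card S ≠ 0 := fun h ↦ by
    rw [h, zero_dvd_iff] at hdvd
    exact hprod hdvd
  refine ⟨Nat.finite_of_card_ne_zero hS0, ?_⟩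
  obtain ⟨c, hc⟩ := hdvd
  have hc0 : c ≠ 0 := fun h ↦ hprod (by rw [hc, h, mul_zero])
  have := congrArg (padicValNat p) hc
  rw [padicValNat.mul hS0 hc0, padicValNat.mul h0 hidx] at this
  omega

end Generic

/-! ## §2 The sockets on Agboola's restricted Selmer groups over the base -/

section Base

open NumberField IsDedekindDomain Field
open Literature.NumberTheory.EllipticCurves.Agboola2007
open Literature.NumberTheory.GaloisRepresentations

variable {K : Type u} [Field K] [NumberField K] (M : Type u) [AddCommGroup M]
  [DistribMulAction (absoluteGaloisGroup K) M] [TopologicalSpace M] [DiscreteTopology M]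
  (p : ℕ) [Fact p.Prime] (𝔮 𝔮' : HeightOneSpectrum (𝓞 K))

/-- **V1⁻ from its two sockets** (the hypothesis `hB : Finite (restrictedSelmerBase M p 𝔮)` of
`LowerStubControl.valuation_constantCoeff_le_of_finite_bottom` together with the bound on `v_p #𝔖_𝔮(K, M)` that `lower_chain`
consumes as `hbot`).  `S₀ = 𝔖_𝔮 ⊓ 𝔖_{𝔮'}` is the group strict at both places above `p` and trivial elsewhere.
Socket V1⁻a: `S₀` finite with `v_p #S₀ ≤ a` (intended `a = ord₂ #Ш(E/K₀)[𝔭*^∞] + ℓ_{𝔭*}`, mechanism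
`finite_and_padicValNat_card_le_of_kummer`).  Socket V1⁻b: `[𝔖_𝔮 : S₀] ≠ 0` with `v_p [𝔖_𝔮 : S₀] ≤ b` (intended
`b = ℓ_𝔭 + t_𝔭`, mechanism `relIndex_ne_zero_and_padicValNat_le_of_loc` fed by `poitouTate_sum_localTatePairing_eq_zero_of_isTotallyComplex`).
[cite: Agboola2007, §6 and Prop. 8.1 (the `≤` half only)] -/
theorem finite_restrictedSelmerBase_and_le_of_split {a b : ℕ}
    (hVa : Finite ↥(restrictedSelmerBase M p 𝔮 ⊓ restrictedSelmerBase M p 𝔮') ∧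
      padicValNat p (Nat.card ↥(restrictedSelmerBase M p 𝔮 ⊓ restrictedSelmerBase M p 𝔮')) ≤ a)
    (hVb : (restrictedSelmerBase M p 𝔮 ⊓ restrictedSelmerBase M p 𝔮').relIndex (restrictedSelmerBase M p 𝔮) ≠ 0 ∧
      padicValNat p
          ((restrictedSelmerBase M p 𝔮 ⊓ restrictedSelmerBase M p 𝔮').relIndex (restrictedSelmerBase M p 𝔮)) ≤ b) :
    Finite ↥(restrictedSelmerBase M p 𝔮) ∧ padicValNat p (Nat.card ↥(restrictedSelmerBase M p 𝔮)) ≤ a + b :=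
  finite_and_padicValNat_card_le_of_split (restrictedSelmerBase M p 𝔮) (restrictedSelmerBase M p 𝔮')
    hVa.1 hVa.2 hVb.1 hVb.2

end Base

end Summit.BirchSwinnertonDyer.BirchSwinnertonDyer.Theorems.PrintCf2.LowerStubBottom

end
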